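import Literature.AnabelianGeometry.SemiGraphs.ArithLevelDataCptOfCosetTowerC
import Literature.AnabelianGeometry.SemiGraphs.ArithLevelDataCptThm54
import Literature.AnabelianGeometry.SemiGraphs.TemperedPiPresentationTowerInputs
import Literature.AnabelianGeometry.SemiGraphs.TemperedPiLevelKernelVerticial
import Literature.AnabelianGeometry.SemiGraphs.TemperedPiLevelsFiniteQuotient
import Literature.AnabelianGeometry.SemiGraphs.ArithPiPresentationOuterCompat
import Literature.AnabelianGeometry.SemiGraphs.ArithTemperedGroupOfOuterAction
import Literature.AnabelianGeometry.SemiGraphs.TemperedPiLevelCosetIso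
import HarnessLib

/-!
# [SemiAnbd] Thm 5.4 (i) AT THE GENUINE ARITHMETIC TEMPERED GROUP `π₁^temp(𝒢) ⋊^out Π_A` of the
# constructed chart — the T54-B CAPSTONE, modulo its named residual inputs

Mochizuki, *Semi-graphs of anabelioids*, Publ. RIMS **42** (2006), §5 Thm 5.4 (i), manuscript p. 66 (l. 50:
"the proofs are entirely parallel to those of Theorem 3.7, Corollary 3.9") [cite: MochizukiSemiAnbd2006, Thm 5.4 (i), p. 66].

CAPSTONE of producer row T54-B (plan/GAP-LEDGER.md G-w4d053-1; seat abc-iut-w4-d029, capstone holder;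
recipe of abc-iut-w4-d053 2026-08-26T05:42:55Z): the typed conclusion `ArithMaximalCompactStatementI D aug` of
abc-iut-L3-t3's `ArithMaximalCompact.lean` for the decomposition data `D := decompositionDataOfChart Rc ι`
PRODUCED (abc-iut-L3-t3/w4-d059, T54-0) from the tempered chart `𝒢.temperedPiChart h36` of [SemiAnbd]
Prop 3.6 and the arithmetic group `E := π₁^temp(𝒢) ⋊^out Π_A` of an outer action `ρ' : Π_A → Out π₁^temp(𝒢)`
(abc-iut-w4-d082 / L3-d2), with `ι : π₁^temp(𝒢) → E`, `aug : E → Π_A`.  It is the COMPOSITION BY NAME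
`ArithLevelDataCpt.arithMaximalCompactStatementI_of (ArithLevelDataCpt.ofCosetTowerC …)` at the subgroup
presentation `P := D.piPresentation T R` of abc-iut-L3-d4 (tree levels `K n := ker ρ_n`, finite levels
`L n := ker π_n`), every input that is a theorem in the tree being BOUND BY NAME: exactness/injectivity of `ι`
(L3-d2/w4-d082 `outerAction_exact`), `hPH`/`hPM` (t6/t8 `range_decompHom_mem_verticialSubgroups`, w4-d082
`piPresentation_M_mem_edgeLikeSubgroups`), `hK`/`hKL`/`hL` (L3-d4 / w4-d085), `hT`, `hfree` (w4-d085
p428097 over L3-d4 p427700), `hHK`/`hMK`/`hlift`/`hliftE` (w4-d085 p427122), the finite quotients (w4-d085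
p428111), the presentation inputs `T`/`R` exist (w4-d029 p422650).  RESIDUAL INPUTS, explicit binders, each
with its owner: a topology on `E` with the two properties used (`IsTopologicalGroup`, open tree-level action
kernels `hKopen` — L3-d2's `exists_topology_arithTemperedGroup_of_kernelSeq`), `hP` (L3-d4/w4-d082:
`isArithCompatible_piPresentation_outerAction_of_thm37` mod hEI/hEc), `hKst`/`hLst` = (E1) Φ-stability of
the levels (OPEN, L3-t9/L3-d4), `noSwitchBase` (PRINT hypothesis of Thm 5.4's frame), `hnobpNCpt` (the
estrangement consequence at the finite coset levels for COMPACT subgroups — abc-iut-L3-t11's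
`noFixedBranchPairSystem_of_isTotallyEstranged_cpt` chain; finding F-d029g3-1), `stabBranchPairAug` = (AI4″)
(abc-iut-w4-d059's producer mod arithmetic cofinality), and Thm 5.4's own hypotheses: total arithmetic
estrangement `hest`, `⊥` not arithmetically ample `hbot`.  Nothing beyond composition is proved here; typed ≠
proved for the residual inputs; no side taken on [IUTchIII] Cor. 3.12.
-/

namespace Literature.AnabelianGeometry.SemiGraphs

namespace ProfiniteSemiGraph

open CategoryTheory Topology
open Literature.AnabelianGeometry.EtaleTheta
open scoped Pointwise

universe u

variable {𝒢 : ProfiniteSemiGraph.{u}}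

/-- **[SemiAnbd] Thm 5.4 (i) at `π₁^temp(𝒢) ⋊^out Π_A` for the chart of Prop 3.6 — the T54-B capstone,
modulo exactly the listed residual inputs** (composition by name; see the module docstring for the owner of
each residual). [cite: MochizukiSemiAnbd2006, Thm 5.4 (i), p. 66] -/
theorem arithMaximalCompactStatementI_outerAction_piPresentation
    (h37 : 𝒢.Thm37Hypotheses) (hG : 𝒢.graph.IsGraph) [Finite 𝒢.graph.Vertex] [Finite 𝒢.graph.Branch]
    {PA : Type u} [Group PA] [TopologicalSpace PA] [IsTopologicalGroup PA]
    (ρ' : PA →* TopOut (𝒢.temperedPiChart h37.toProp36Hypotheses).G) (baseAct : PA →* Aut 𝒢.graph)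
    [TopologicalSpace (outerSemidirectProduct ρ')] [IsTopologicalGroup (outerSemidirectProduct ρ')]
    (T : ∀ w : 𝒢.graph.Vertex, (𝒢.galoisLevelData h37.toProp36Hypotheses).PointSeq h37.toProp36Hypotheses.isCountable w) (R : SemiGraph.RefBranches 𝒢.graph)
    (Rc : ChartRepresentatives (𝒢.temperedPiChart h37.toProp36Hypotheses))
    (hP : ((𝒢.galoisLevelData h37.toProp36Hypotheses).piPresentation h37.toProp36Hypotheses.isCountable T R).IsArithCompatible (((contMulAut (𝒢.temperedPiChart h37.toProp36Hypotheses).G).subtype.comp (MonoidHom.fst (contMulAut (𝒢.temperedPiChart h37.toProp36Hypotheses).G) PA)).comp (outerSemidirectProduct ρ').subtype) (baseAct.comp (outerSemidirectProductSnd ρ')))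
    (w₀ : 𝒢.graph.Vertex)
    (hKst : ∀ (n : ℕ) (e : outerSemidirectProduct ρ') (x : (𝒢.temperedPiChart h37.toProp36Hypotheses).G), x ∈ ((𝒢.galoisLevelData h37.toProp36Hypotheses).projAut h37.toProp36Hypotheses.isCountable n).ker → (((contMulAut (𝒢.temperedPiChart h37.toProp36Hypotheses).G).subtype.comp (MonoidHom.fst (contMulAut (𝒢.temperedPiChart h37.toProp36Hypotheses).G) PA)).comp (outerSemidirectProduct ρ').subtype) e x ∈ ((𝒢.galoisLevelData h37.toProp36Hypotheses).projAut h37.toProp36Hypotheses.isCountable n).ker)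
    (hLst : ∀ (n : ℕ) (e : outerSemidirectProduct ρ') (x : (𝒢.temperedPiChart h37.toProp36Hypotheses).G), x ∈ ((𝒢.galoisLevelData h37.toProp36Hypotheses).piLevelAut h37.toProp36Hypotheses.isCountable (𝒢.galoisLevelData_hconn h37.toProp36Hypotheses) n).ker → (((contMulAut (𝒢.temperedPiChart h37.toProp36Hypotheses).G).subtype.comp (MonoidHom.fst (contMulAut (𝒢.temperedPiChart h37.toProp36Hypotheses).G) PA)).comp (outerSemidirectProduct ρ').subtype) e x ∈ ((𝒢.galoisLevelData h37.toProp36Hypotheses).piLevelAut h37.toProp36Hypotheses.isCountable (𝒢.galoisLevelData_hconn h37.toProp36Hypotheses) n).ker)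
    (hKopen : ∀ n, IsOpen ((((𝒢.galoisLevelData h37.toProp36Hypotheses).piPresentation h37.toProp36Hypotheses.isCountable T R).arithAct hP ((𝒢.galoisLevelData h37.toProp36Hypotheses).projAut h37.toProp36Hypotheses.isCountable n).ker (hKst n)).ker : Set (outerSemidirectProduct ρ')))
    (noSwitchBase : NoBranchSwitching 𝒢.graph.edgeOf
      (fun (a : PA) (b : 𝒢.graph.Branch) => (baseAct a).hom.branchMap b))
    (hnobpNCpt : ∀ (C : Subgroup (𝒢.temperedPiChart h37.toProp36Hypotheses).G), IsCompact (C : Set (𝒢.temperedPiChart h37.toProp36Hypotheses).G) →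
      ∀ (j₀ : ℕ) (w : ∀ i : {i : ℕ // j₀ ≤ i}, (((𝒢.galoisLevelData h37.toProp36Hypotheses).piPresentation h37.toProp36Hypotheses.isCountable T R).cosetGraph ((𝒢.galoisLevelData h37.toProp36Hypotheses).piLevelAut h37.toProp36Hypotheses.isCountable (𝒢.galoisLevelData_hconn h37.toProp36Hypotheses) i.1).ker).Vertex)
      (β β' : ∀ i : {i : ℕ // j₀ ≤ i}, (((𝒢.galoisLevelData h37.toProp36Hypotheses).piPresentation h37.toProp36Hypotheses.isCountable T R).cosetGraph ((𝒢.galoisLevelData h37.toProp36Hypotheses).piLevelAut h37.toProp36Hypotheses.isCountable (𝒢.galoisLevelData_hconn h37.toProp36Hypotheses) i.1).ker).Branch),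
      (∀ i, β i ≠ β' i ∧ (((𝒢.galoisLevelData h37.toProp36Hypotheses).piPresentation h37.toProp36Hypotheses.isCountable T R).cosetGraph ((𝒢.galoisLevelData h37.toProp36Hypotheses).piLevelAut h37.toProp36Hypotheses.isCountable (𝒢.galoisLevelData_hconn h37.toProp36Hypotheses) i.1).ker).abuts (β i) = some (w i) ∧
        (((𝒢.galoisLevelData h37.toProp36Hypotheses).piPresentation h37.toProp36Hypotheses.isCountable T R).cosetGraph ((𝒢.galoisLevelData h37.toProp36Hypotheses).piLevelAut h37.toProp36Hypotheses.isCountable (𝒢.galoisLevelData_hconn h37.toProp36Hypotheses) i.1).ker).abuts (β' i) = some (w i)) →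
      (∀ ⦃i i' : {i : ℕ // j₀ ≤ i}⦄ (h : i.1 ≤ i'.1),
        (((𝒢.galoisLevelData h37.toProp36Hypotheses).piPresentation h37.toProp36Hypotheses.isCountable T R).cosetGraphTrans ((𝒢.galoisLevelData h37.toProp36Hypotheses).ker_piLevelAut_anti h37.toProp36Hypotheses.isCountable (𝒢.galoisLevelData_hconn h37.toProp36Hypotheses) h)).vertexMap (w i') = w i ∧
        (((𝒢.galoisLevelData h37.toProp36Hypotheses).piPresentation h37.toProp36Hypotheses.isCountable T R).cosetGraphTrans ((𝒢.galoisLevelData h37.toProp36Hypotheses).ker_piLevelAut_anti h37.toProp36Hypotheses.isCountable (𝒢.galoisLevelData_hconn h37.toProp36Hypotheses) h)).branchMap (β i') = β i ∧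
          (((𝒢.galoisLevelData h37.toProp36Hypotheses).piPresentation h37.toProp36Hypotheses.isCountable T R).cosetGraphTrans ((𝒢.galoisLevelData h37.toProp36Hypotheses).ker_piLevelAut_anti h37.toProp36Hypotheses.isCountable (𝒢.galoisLevelData_hconn h37.toProp36Hypotheses) h)).branchMap (β' i') = β' i) →
      (∀ (i : {i : ℕ // j₀ ≤ i}) (γ : C),
        (((𝒢.galoisLevelData h37.toProp36Hypotheses).piPresentation h37.toProp36Hypotheses.isCountable T R).arithAct hP ((𝒢.galoisLevelData h37.toProp36Hypotheses).piLevelAut h37.toProp36Hypotheses.isCountable (𝒢.galoisLevelData_hconn h37.toProp36Hypotheses) i.1).ker (hLst i.1) ((toOuterSemidirectProduct ρ') γ)).hom.vertexMap (w i) = w i ∧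
        (((𝒢.galoisLevelData h37.toProp36Hypotheses).piPresentation h37.toProp36Hypotheses.isCountable T R).arithAct hP ((𝒢.galoisLevelData h37.toProp36Hypotheses).piLevelAut h37.toProp36Hypotheses.isCountable (𝒢.galoisLevelData_hconn h37.toProp36Hypotheses) i.1).ker (hLst i.1) ((toOuterSemidirectProduct ρ') γ)).hom.branchMap (β i) = β i ∧
          (((𝒢.galoisLevelData h37.toProp36Hypotheses).piPresentation h37.toProp36Hypotheses.isCountable T R).arithAct hP ((𝒢.galoisLevelData h37.toProp36Hypotheses).piLevelAut h37.toProp36Hypotheses.isCountable (𝒢.galoisLevelData_hconn h37.toProp36Hypotheses) i.1).ker (hLst i.1) ((toOuterSemidirectProduct ρ') γ)).hom.branchMap (β' i) = β' i) → C = ⊥)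
    (stabBranchPairAug : ∀ (C : Subgroup (outerSemidirectProduct ρ')),
      IsCompact (C : Set (outerSemidirectProduct ρ')) →
      ∀ (j₀ : ℕ) (w : ∀ i : {i : ℕ // j₀ ≤ i}, (((𝒢.galoisLevelData h37.toProp36Hypotheses).piPresentation h37.toProp36Hypotheses.isCountable T R).cosetGraph ((𝒢.galoisLevelData h37.toProp36Hypotheses).piLevelAut h37.toProp36Hypotheses.isCountable (𝒢.galoisLevelData_hconn h37.toProp36Hypotheses) i.1).ker).Vertex)
      (β β' : ∀ i : {i : ℕ // j₀ ≤ i}, (((𝒢.galoisLevelData h37.toProp36Hypotheses).piPresentation h37.toProp36Hypotheses.isCountable T R).cosetGraph ((𝒢.galoisLevelData h37.toProp36Hypotheses).piLevelAut h37.toProp36Hypotheses.isCountable (𝒢.galoisLevelData_hconn h37.toProp36Hypotheses) i.1).ker).Branch),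
      (∀ i, β i ≠ β' i ∧ (((𝒢.galoisLevelData h37.toProp36Hypotheses).piPresentation h37.toProp36Hypotheses.isCountable T R).cosetGraph ((𝒢.galoisLevelData h37.toProp36Hypotheses).piLevelAut h37.toProp36Hypotheses.isCountable (𝒢.galoisLevelData_hconn h37.toProp36Hypotheses) i.1).ker).abuts (β i) = some (w i) ∧
        (((𝒢.galoisLevelData h37.toProp36Hypotheses).piPresentation h37.toProp36Hypotheses.isCountable T R).cosetGraph ((𝒢.galoisLevelData h37.toProp36Hypotheses).piLevelAut h37.toProp36Hypotheses.isCountable (𝒢.galoisLevelData_hconn h37.toProp36Hypotheses) i.1).ker).abuts (β' i) = some (w i)) →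
      (∀ ⦃i i' : {i : ℕ // j₀ ≤ i}⦄ (h : i.1 ≤ i'.1),
        (((𝒢.galoisLevelData h37.toProp36Hypotheses).piPresentation h37.toProp36Hypotheses.isCountable T R).cosetGraphTrans ((𝒢.galoisLevelData h37.toProp36Hypotheses).ker_piLevelAut_anti h37.toProp36Hypotheses.isCountable (𝒢.galoisLevelData_hconn h37.toProp36Hypotheses) h)).vertexMap (w i') = w i ∧
        (((𝒢.galoisLevelData h37.toProp36Hypotheses).piPresentation h37.toProp36Hypotheses.isCountable T R).cosetGraphTrans ((𝒢.galoisLevelData h37.toProp36Hypotheses).ker_piLevelAut_anti h37.toProp36Hypotheses.isCountable (𝒢.galoisLevelData_hconn h37.toProp36Hypotheses) h)).branchMap (β i') = β i ∧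
          (((𝒢.galoisLevelData h37.toProp36Hypotheses).piPresentation h37.toProp36Hypotheses.isCountable T R).cosetGraphTrans ((𝒢.galoisLevelData h37.toProp36Hypotheses).ker_piLevelAut_anti h37.toProp36Hypotheses.isCountable (𝒢.galoisLevelData_hconn h37.toProp36Hypotheses) h)).branchMap (β' i') = β' i) →
      (∀ (i : {i : ℕ // j₀ ≤ i}) (g : outerSemidirectProduct ρ'), g ∈ C →
        (((𝒢.galoisLevelData h37.toProp36Hypotheses).piPresentation h37.toProp36Hypotheses.isCountable T R).arithAct hP ((𝒢.galoisLevelData h37.toProp36Hypotheses).piLevelAut h37.toProp36Hypotheses.isCountable (𝒢.galoisLevelData_hconn h37.toProp36Hypotheses) i.1).ker (hLst i.1) g).hom.vertexMap (w i) = w i ∧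
        (((𝒢.galoisLevelData h37.toProp36Hypotheses).piPresentation h37.toProp36Hypotheses.isCountable T R).arithAct hP ((𝒢.galoisLevelData h37.toProp36Hypotheses).piLevelAut h37.toProp36Hypotheses.isCountable (𝒢.galoisLevelData_hconn h37.toProp36Hypotheses) i.1).ker (hLst i.1) g).hom.branchMap (β i) = β i ∧
          (((𝒢.galoisLevelData h37.toProp36Hypotheses).piPresentation h37.toProp36Hypotheses.isCountable T R).arithAct hP ((𝒢.galoisLevelData h37.toProp36Hypotheses).piLevelAut h37.toProp36Hypotheses.isCountable (𝒢.galoisLevelData_hconn h37.toProp36Hypotheses) i.1).ker (hLst i.1) g).hom.branchMap (β' i) = β' i) →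
      ∃ (v : 𝒢.graph.Vertex) (b b' : 𝒢.graph.Branch) (a : PA) (h : outerSemidirectProduct ρ'),
        (decompositionDataOfChart Rc (toOuterSemidirectProduct ρ')).abut b = some v ∧ (decompositionDataOfChart Rc (toOuterSemidirectProduct ρ')).abut b' = some v ∧
        h ∈ (decompositionDataOfChart Rc (toOuterSemidirectProduct ρ')).vertGp v ∧ (b' ≠ b ∨ h ∉ (decompositionDataOfChart Rc (toOuterSemidirectProduct ρ')).brGp b) ∧
        C.map (outerSemidirectProductSnd ρ') ≤ conjSubgroup a (((decompositionDataOfChart Rc (toOuterSemidirectProduct ρ')).brGp b ⊓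
          conjSubgroup h ((decompositionDataOfChart Rc (toOuterSemidirectProduct ρ')).brGp b')).map (outerSemidirectProductSnd ρ')))
    (hest : IsTotallyArithEstranged (decompositionDataOfChart Rc (toOuterSemidirectProduct ρ')) (outerSemidirectProductSnd ρ')) (hbot : ¬ IsArithAmple (outerSemidirectProductSnd ρ') ⊥) :
    ArithMaximalCompactStatementI (decompositionDataOfChart Rc (toOuterSemidirectProduct ρ')) (outerSemidirectProductSnd ρ') := by
  -- exactness of `1 → π₁^temp → E → Π_A → 1` (temp-slimness)
  obtain ⟨hι, hex, -⟩ := outerAction_exact (𝒢.temperedPiChart h37.toProp36Hypotheses) ρ' h37.toProp36Hypotheses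
  have hnorm : ((toOuterSemidirectProduct ρ').range).Normal := by rw [hex]; infer_instance
  have hιΦ : ∀ g : (𝒢.temperedPiChart h37.toProp36Hypotheses).G, (((contMulAut (𝒢.temperedPiChart h37.toProp36Hypotheses).G).subtype.comp (MonoidHom.fst (contMulAut (𝒢.temperedPiChart h37.toProp36Hypotheses).G) PA)).comp (outerSemidirectProduct ρ').subtype) ((toOuterSemidirectProduct ρ') g) = MulAut.conj g := fun _ => rfl
  have hισ : ∀ g : (𝒢.temperedPiChart h37.toProp36Hypotheses).G, (baseAct.comp (outerSemidirectProductSnd ρ')) ((toOuterSemidirectProduct ρ') g) = 1 := fun g => by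
    have hg : (toOuterSemidirectProduct ρ') g ∈ (outerSemidirectProductSnd ρ').ker := hex ▸ ⟨g, rfl⟩
    rw [MonoidHom.comp_apply, (MonoidHom.mem_ker).mp hg, map_one]
  have hPH : ∀ w, ((𝒢.galoisLevelData h37.toProp36Hypotheses).piPresentation h37.toProp36Hypotheses.isCountable T R).H w ∈ verticialSubgroups (𝒢.temperedPiChart h37.toProp36Hypotheses) w := fun w => by
    rw [GaloisLevelData.piPresentation_H]
    exact (T w).range_decompHom_mem_verticialSubgroups
  let Lc := @ArithLevelDataCpt.ofCosetTowerC 𝒢 (𝒢.temperedPiChart h37.toProp36Hypotheses) h37 hG _ _ Rc (outerSemidirectProduct ρ') _ _ PA _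
    (toOuterSemidirectProduct ρ') hι hnorm (outerSemidirectProductSnd ρ') baseAct ((𝒢.galoisLevelData h37.toProp36Hypotheses).piPresentation h37.toProp36Hypotheses.isCountable T R) _ hP hιΦ hισ hPH
    (fun ε => piPresentation_M_mem_edgeLikeSubgroups h37.toProp36Hypotheses T R ε) w₀
    (fun n => ((𝒢.galoisLevelData h37.toProp36Hypotheses).projAut h37.toProp36Hypotheses.isCountable n).ker) (fun _ => MonoidHom.normal_ker _) ((𝒢.galoisLevelData h37.toProp36Hypotheses).ker_projAut_anti h37.toProp36Hypotheses.isCountable)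
    hKst ((𝒢.galoisLevelData h37.toProp36Hypotheses).piPresentation_hT h37.toProp36Hypotheses.isCountable T R) hKopen noSwitchBase
    ((𝒢.galoisLevelData h37.toProp36Hypotheses).piPresentation_hHK h37.toProp36Hypotheses.isCountable T R) ((𝒢.galoisLevelData h37.toProp36Hypotheses).piPresentation_hMK h37.toProp36Hypotheses.isCountable T R)
    ((𝒢.galoisLevelData h37.toProp36Hypotheses).piPresentation_hlift h37.toProp36Hypotheses.isCountable T R) ((𝒢.galoisLevelData h37.toProp36Hypotheses).piPresentation_hliftE h37.toProp36Hypotheses.isCountable T R)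
    (fun n => ((𝒢.galoisLevelData h37.toProp36Hypotheses).piLevelAut h37.toProp36Hypotheses.isCountable (𝒢.galoisLevelData_hconn h37.toProp36Hypotheses) n).ker) (fun _ => MonoidHom.normal_ker _)
    (fun j => (𝒢.galoisLevelData h37.toProp36Hypotheses).finite_quotient_ker_piLevelAut h37.toProp36Hypotheses.isCountable (𝒢.galoisLevelData_hconn h37.toProp36Hypotheses)
      (𝒢.galoisLevelData_isFinite h37.toProp36Hypotheses) j)
    ((𝒢.galoisLevelData h37.toProp36Hypotheses).ker_piLevelAut_anti h37.toProp36Hypotheses.isCountable (𝒢.galoisLevelData_hconn h37.toProp36Hypotheses)) hLst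
    (fun n => (𝒢.galoisLevelData h37.toProp36Hypotheses).ker_projAut_le_ker_piLevelAut h37.toProp36Hypotheses.isCountable (𝒢.galoisLevelData_hconn h37.toProp36Hypotheses) n)
    ((𝒢.galoisLevelData h37.toProp36Hypotheses).piPresentation_hfree h37.toProp36Hypotheses.isCountable (𝒢.galoisLevelData_hconn h37.toProp36Hypotheses) T R) hnobpNCpt stabBranchPairAug
  exact Lc.arithMaximalCompactStatementI_of (abut_isSome_of_isGraph Rc (toOuterSemidirectProduct ρ') hG) hest hbot

end ProfiniteSemiGraph

end Literature.AnabelianGeometry.SemiGraphs
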